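import Mathlib.Analysis.InnerProductSpace.Positive
import Literature.Analysis.OperatorTheory.FeshbachSchurMap
import HarnessLib

/-!
# The Feshbach–Schur map on a Hilbert space: the quadratic-form identity, transmission of positivity,
# and the variational (min–max) Feshbach principle with a spectral gap in the complementary sector

Companion of `Literature.Analysis.OperatorTheory.FeshbachSchurMap` (the ALGEBRAIC core of Gustafson–Sigal, *Mathematical Concepts
of Quantum Mechanics* (2003) §11.1 Thm. 11.1 in an arbitrary ring).  Here the ring is `E →L[𝕜] E`, the bounded operators of a Hilbert
space `E` over `𝕜 = ℝ, ℂ`, `P` is an ORTHOGONAL projection (`IsStarProjection P`), `T` is bounded self-adjoint, and `R = R_{P̄}` is a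
corner inverse of the «stiff block» `P̄TP̄` on `Ran P̄` (`P̄ = 1 − P`), i.e. the four relations `P̄R = R = RP̄`, `P̄TR = P̄`, `RTP̄ = P̄` of the
companion file.  Printed sources: Gustafson–Sigal §12.2 (the Feshbach–Schur method with an infinite-rank projection, conditions (a)
«`H^⊥ − λ` invertible», (b), the decomposition `F_P(H − λ) = (PHP − U(λ)) ↾ Ran P`, `U(λ) = PHP̄(H^⊥ − λ)⁻¹P̄HP` (12.8)–(12.9), the
eigenvalue/eigenvector correspondence (12.10)–(12.11), and the gap mechanism `P̄HP̄ > λ_* P̄` (12.17) producing (a)) [held: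
`book:gustafson2003-mathematical-concepts-quantum-mechanics` p0142–p0146]; the completion-of-the-square («Schur complement»)
criterion for block operators, Horn–Johnson, *Matrix Analysis* (2nd ed. 2013) Thm. 7.7.7 (a)⇔(b) with the `*`-congruence (7.7.5)
[held: `book:horn2012-matrix-analysis` p0607].

## What is here (all PROVED; no definitions, no named facts)
§1 `inner_eq_inner_fsMap_add` — the QUADRATIC-FORM IDENTITY behind (12.9)/(7.7.5): for every `ψ`, with `φ := Pψ` and
   `η := ψ − Q φ ∈ Ran P̄` (`Q = fsQ T P R = P − RTP`, (11.8)),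
   `⟪Tψ, ψ⟫ = ⟪F_P(T) φ, φ⟫ + ⟪Tη, η⟫`,   `F_P(T) = fsMap T P R = PTP − PTRTP`,
   and `⟪T(Qφ), Qφ⟫ = ⟪F_P(T)φ, φ⟫` on `Ran P` (`inner_apply_fsQ`).  Only `P̄R = R` and `P̄TR = P̄` are used.
§2 TRANSMISSION OF POSITIVITY (the operator form of Horn–Johnson 7.7.7 (a)⇔(b) / of (12.10) at the bottom of the spectrum): if the
   stiff block is nonnegative, `⟪Tx, x⟫ ≥ 0` on `Ran P̄`, then for every set `S ⊆ Ran P` of constraint vectors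
   `(∀ ψ ⊥ S, 0 ≤ re⟪Tψ, ψ⟫) ⟺ (∀ φ ∈ Ran P, φ ⊥ S → 0 ≤ re⟪F_P(T)φ, φ⟫)`  (`forall_orth_nonneg_iff_fsMap`),
   the mirror statement for `≤ 0` (`forall_orth_nonpos_iff_fsMap`), and the Loewner form `T.IsPositive ↔ (fsMap T P R).IsPositive`
   (`isPositive_iff_isPositive_fsMap`).  Constraints in `Ran P` pass through because `P(Qφ) = φ`, `PR = 0`.
§3 THE CORNER INVERSE: uniqueness (`corner_inverse_unique`, ring lemma), hence SELF-ADJOINTNESS of `R_{P̄}` for self-adjoint data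
   (`isSelfAdjoint_cornerInverse`), positivity `0 ≤ re⟪Rx, x⟫` when the stiff block is nonnegative, the bounds `‖Rx‖ ≤ δ⁻¹‖x‖`,
   `re⟪Rx, x⟫ ≤ δ⁻¹‖x‖²` under coercivity `⟪Tx, x⟫ ≥ δ‖x‖²` on `Ran P̄`, and EXISTENCE from coercivity alone (`exists_fsData_of_coercive`,
   no self-adjointness needed: the block-diagonal operator `P + P̄TP̄` is bounded below, hence a unit (`ContinuousLinearMap.isUnit_of_forall_le_norm_inner_map`),
   and the companion file's `exists_corner_inverse_of_isUnit_add` finishes) — this is the book's (12.17) ⟹ condition (a).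
§4 ★ THE VARIATIONAL FESHBACH PRINCIPLE in the two shapes used by min–max arguments:
   * `feshbach_inf_principle` (Schrödinger form): `H` self-adjoint, `⟪Hx, x⟫ ≥ (λ + δ)‖x‖²` on `Ran P̄` (the stiff sector lies ABOVE `λ`).
     Then there is `R = (H^⊥ − λ)⁻¹ ≥ 0` on `Ran P̄` (self-adjoint, `‖R‖ ≤ δ⁻¹`) such that for every `S ⊆ Ran P`:
     `(∀ ψ ⊥ S, λ‖ψ‖² ≤ re⟪Hψ, ψ⟫) ⟺ (∀ φ ∈ Ran P ∩ S^⊥, λ‖φ‖² ≤ re⟪(PHP − PHRHP)φ, φ⟫)`.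
   * `feshbach_sup_principle` (transfer-operator form): `K` self-adjoint, `⟪Kx, x⟫ ≤ (μ − δ)‖x‖²` on `Ran P̄` (the stiff sector lies
     BELOW `μ`).  Then there is `G = (μ − K^⊥)⁻¹ ≥ 0` on `Ran P̄` (self-adjoint, `‖G‖ ≤ δ⁻¹`) such that for every `S ⊆ Ran P`:
     `(∀ ψ ⊥ S, re⟪Kψ, ψ⟫ ≤ μ‖ψ‖²) ⟺ (∀ φ ∈ Ran P ∩ S^⊥, re⟪(PKP + PKGKP)φ, φ⟫ ≤ μ‖φ‖²)`:
     «no state orthogonal to `S` has Rayleigh quotient above `μ`» is EQUIVALENT to the same statement for the slow-sector effective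
     transfer operator `PKP + PK(μ − K^⊥)⁻¹KP` — the exact (lossless) input shape of an inf–sup («no intruders») door.

Use (cell `ym-beyond`, route `LuscherReduction`, crux RED `RunningReduction`, lever (b) «Feshbach–Schur on the stiff sector»; and
any Courant–Fischer argument that integrates out a gapped sector): `E = L²` of the fine lattice, `K` the transfer operator, `P` the
conditional expectation onto slow variables, `S` = the `k` constraint functions (slow, i.e. in `Ran P`).

## References
* S. J. Gustafson, I. M. Sigal, *Mathematical Concepts of Quantum Mechanics*, Springer 2003, §11.1 Thm. 11.1; §12.2 (12.8)–(12.11), (12.17). [GustafsonSigal2003]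
* R. A. Horn, C. R. Johnson, *Matrix Analysis*, 2nd ed., CUP 2013, Thm. 7.7.7, (7.7.5). [HornJohnson2013]
-/

set_option autoImplicit false

open scoped InnerProductSpace
open RCLike

namespace Literature.Analysis.OperatorTheory.FeshbachSchur

/-! ## §3a Uniqueness of corner inverses (ring lemma) -/

section RingUnique

variable {A : Type*} [Ring A] {P T R R' : A}

/-- Corner inverses are unique: if `R = RP̄` inverts `T` from the left in the corner (`RTP̄ = P̄`) and `R' = P̄R'` inverts it from the right
(`P̄TR' = P̄`), then `R = R'` (both equal `RTR'`).  [cite: GustafsonSigal2003, §11.1 (11.6)] -/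
theorem corner_inverse_unique (hRr : R * (1 - P) = R) (hR'l : (1 - P) * R' = R')
    (hinv₂ : R * T * (1 - P) = 1 - P) (hinv₁' : (1 - P) * T * R' = 1 - P) : R = R' := by
  have h1 : R = R * T * R' := by
    calc R = R * (1 - P) := hRr.symm
      _ = R * ((1 - P) * T * R') := by rw [hinv₁']
      _ = R * (1 - P) * T * R' := by simp only [mul_assoc]
      _ = R * T * R' := by rw [hRr]
  have h2 : R' = R * T * R' := by
    calc R' = (1 - P) * R' := hR'l.symm
      _ = R * T * (1 - P) * R' := by rw [hinv₂]
      _ = R * T * ((1 - P) * R') := by simp only [mul_assoc]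
      _ = R * T * R' := by rw [hR'l]
  rw [h1, ← h2]

/-- `RTR = R` for a corner inverse (`R = P̄R`, `RTP̄ = P̄`). [cite: GustafsonSigal2003, §11.1 (11.6)] -/
theorem cornerInverse_mul_mul_self (hRl : (1 - P) * R = R) (hinv₂ : R * T * (1 - P) = 1 - P) : R * T * R = R := by
  calc R * T * R = R * T * ((1 - P) * R) := by rw [hRl]
    _ = R * T * (1 - P) * R := by simp only [mul_assoc]
    _ = R := by rw [hinv₂, hRl]

end RingUnique

section Hilbert

variable {𝕜 : Type*} [RCLike 𝕜] {E : Type*} [NormedAddCommGroup E] [InnerProductSpace 𝕜 E] [CompleteSpace E]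
variable {T P R : E →L[𝕜] E}

/-! ## §0 Small operator facts -/

/-- An orthogonal projection is symmetric: `⟪Px, y⟫ = ⟪x, Py⟫`. [folklore] -/
private theorem inner_proj_left (hP : IsStarProjection P) (x y : E) : ⟪P x, y⟫_𝕜 = ⟪x, P y⟫_𝕜 :=
  hP.isSelfAdjoint.isSymmetric x y

/-- `⟪Px, x⟫ = ⟪Px, Px⟫` for an orthogonal projection. [folklore] -/
private theorem inner_proj_self (hP : IsStarProjection P) (x : E) : ⟪P x, x⟫_𝕜 = ⟪P x, P x⟫_𝕜 := by
  have hPP : P * P = P := hP.isIdempotentElem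
  calc ⟪P x, x⟫_𝕜 = ⟪P (P x), x⟫_𝕜 := by rw [← mul_apply_eq_comp, hPP]
    _ = ⟪P x, P x⟫_𝕜 := inner_proj_left hP _ _

/-- `P(Ry) = 0` when `R = P̄R` (`PR = 0`). [cite: GustafsonSigal2003, §11.4 (proof of (11.29))] -/
theorem proj_apply_cornerInverse (hP : IsStarProjection P) (hRl : (1 - P) * R = R) (y : E) : P (R y) = 0 := by
  have h := P_mul_R (hP.isIdempotentElem : P * P = P) hRl
  have := congrArg (fun S : E →L[𝕜] E => S y) h
  simpa using this

/-- `P((1 − P)x) = 0`. [folklore] -/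
private theorem proj_apply_one_sub (hP : IsStarProjection P) (x : E) : P ((1 - P) x) = 0 := by
  have hPP : P * P = P := hP.isIdempotentElem
  have : (P * (1 - P)) x = 0 := by rw [mul_sub, mul_one, hPP, sub_self]; simp
  simpa using this

/-- Pythagoras for `x = Px + P̄x`. [folklore] -/
private theorem norm_sq_eq_proj_add (hP : IsStarProjection P) (x : E) : ‖x‖ ^ 2 = ‖P x‖ ^ 2 + ‖(1 - P) x‖ ^ 2 := by
  have horth : ⟪P x, (1 - P) x⟫_𝕜 = 0 := by
    rw [inner_proj_left hP, proj_apply_one_sub hP, inner_zero_right]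
  have hsum : x = P x + (1 - P) x := by simp
  have h := norm_add_sq_eq_norm_sq_add_norm_sq_of_inner_eq_zero (P x) ((1 - P) x) horth
  calc ‖x‖ ^ 2 = ‖P x + (1 - P) x‖ ^ 2 := by rw [← hsum]
    _ = ‖P x‖ ^ 2 + ‖(1 - P) x‖ ^ 2 := by
        rw [sq, sq, sq]; exact h

/-- Constraint vectors in `Ran P` see only the `P`-component: `⟪s, Pψ⟫ = ⟪s, ψ⟫` for `Ps = s`. [folklore] -/
private theorem inner_proj_right_of_mem_range (hP : IsStarProjection P) {s : E} (hs : P s = s) (ψ : E) :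
    ⟪s, P ψ⟫_𝕜 = ⟪s, ψ⟫_𝕜 := by
  rw [← inner_proj_left hP, hs]

/-- Constraint vectors in `Ran P` do not see the Feshbach correction: `⟪s, Qφ⟫ = ⟪s, Pφ⟫` for `Ps = s` (`Q = P − RTP`, `PR = 0`).
[cite: GustafsonSigal2003, §11.4 (11.29)] -/
theorem inner_fsQ_right_of_mem_range (hP : IsStarProjection P) (hRl : (1 - P) * R = R) {s : E} (hs : P s = s) (φ : E) :
    ⟪s, fsQ T P R φ⟫_𝕜 = ⟪s, P φ⟫_𝕜 := by
  have hQ : fsQ T P R φ = P φ - R (T (P φ)) := by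
    rw [fsQ_def]; simp
  have hR : ⟪s, R (T (P φ))⟫_𝕜 = 0 := by
    rw [← hs, inner_proj_left hP, proj_apply_cornerInverse hP hRl, inner_zero_right]
  rw [hQ, inner_sub_right, hR, sub_zero]

/-! ## §1 The quadratic-form identity -/

/-- ★ **The Feshbach–Schur quadratic-form identity.**  For an orthogonal projection `P`, a bounded self-adjoint `T`, and `R` with
`P̄R = R`, `P̄TR = P̄` (`P̄ = 1 − P`): for every `ψ`, writing `φ = Pψ`, `Q = P − RTP` and `η = ψ − Qφ` (so `ψ = Qφ + η`, `Pη = 0`),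
`⟪Tψ, ψ⟫ = ⟪F_P(T)φ, φ⟫ + ⟪Tη, η⟫` with `F_P(T) = PTP − PTRTP` — the block completion of the square (`*`-congruence (7.7.5)) behind the
decomposition `F_P(H − λ) = PHP − λ − U(λ)` (12.9): the cross terms vanish because `T·Q = F_P(T)` lands in `Ran P` ((11.30)) while `η ∈ Ran P̄`.
[cite: GustafsonSigal2003, §12.2 (12.8)–(12.9); §11.4 (11.30)] [cite: HornJohnson2013, (7.7.5)] -/
theorem inner_eq_inner_fsMap_add (hP : IsStarProjection P) (hT : IsSelfAdjoint T)
    (hRl : (1 - P) * R = R) (hinv₁ : (1 - P) * T * R = 1 - P) (ψ : E) :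
    ⟪T ψ, ψ⟫_𝕜 = ⟪fsMap T P R (P ψ), P ψ⟫_𝕜 +
      ⟪T (ψ - fsQ T P R (P ψ)), ψ - fsQ T P R (P ψ)⟫_𝕜 := by
  have hPP : P * P = P := hP.isIdempotentElem
  set φ : E := P ψ with hφ
  set η : E := ψ - fsQ T P R φ with hη
  have hψ : ψ = fsQ T P R φ + η := by rw [hη]; abel
  have hTQ : T (fsQ T P R φ) = fsMap T P R φ := by rw [← mul_apply_eq_comp, mul_fsQ hinv₁]
  have hPF : P (fsMap T P R φ) = fsMap T P R φ := by rw [← mul_apply_eq_comp, P_mul_fsMap hPP]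
  have hPQφ : P (fsQ T P R φ) = φ := by
    rw [← mul_apply_eq_comp, P_mul_fsQ hPP hRl, hφ, ← mul_apply_eq_comp, hPP]
  have hPη : P η = 0 := by
    rw [hη, map_sub, hPQφ, hφ, sub_self]
  have c1 : ⟪fsMap T P R φ, η⟫_𝕜 = 0 := by
    calc ⟪fsMap T P R φ, η⟫_𝕜 = ⟪P (fsMap T P R φ), η⟫_𝕜 := by rw [hPF]
      _ = ⟪fsMap T P R φ, P η⟫_𝕜 := inner_proj_left hP _ _
      _ = 0 := by rw [hPη, inner_zero_right]
  have c2 : ⟪T η, fsQ T P R φ⟫_𝕜 = 0 := by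
    calc ⟪T η, fsQ T P R φ⟫_𝕜 = ⟪η, T (fsQ T P R φ)⟫_𝕜 := hT.isSymmetric _ _
      _ = ⟪η, P (fsMap T P R φ)⟫_𝕜 := by rw [hTQ, hPF]
      _ = ⟪P η, fsMap T P R φ⟫_𝕜 := (inner_proj_left hP _ _).symm
      _ = 0 := by rw [hPη, inner_zero_left]
  have c3 : ⟪fsMap T P R φ, fsQ T P R φ⟫_𝕜 = ⟪fsMap T P R φ, φ⟫_𝕜 := by
    calc ⟪fsMap T P R φ, fsQ T P R φ⟫_𝕜 = ⟪P (fsMap T P R φ), fsQ T P R φ⟫_𝕜 := by rw [hPF]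
      _ = ⟪fsMap T P R φ, P (fsQ T P R φ)⟫_𝕜 := inner_proj_left hP _ _
      _ = ⟪fsMap T P R φ, φ⟫_𝕜 := by rw [hPQφ]
  conv_lhs => rw [hψ]
  rw [map_add, hTQ, inner_add_left, inner_add_right, inner_add_right, c1, c2, c3, add_zero, zero_add]

/-- Real-part form of `inner_eq_inner_fsMap_add`. [cite: GustafsonSigal2003, §12.2 (12.9)] [cite: HornJohnson2013, (7.7.5)] -/
theorem re_inner_eq_re_inner_fsMap_add (hP : IsStarProjection P) (hT : IsSelfAdjoint T)
    (hRl : (1 - P) * R = R) (hinv₁ : (1 - P) * T * R = 1 - P) (ψ : E) :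
    re ⟪T ψ, ψ⟫_𝕜 = re ⟪fsMap T P R (P ψ), P ψ⟫_𝕜 +
      re ⟪T (ψ - fsQ T P R (P ψ)), ψ - fsQ T P R (P ψ)⟫_𝕜 := by
  rw [inner_eq_inner_fsMap_add hP hT hRl hinv₁ ψ, map_add]

/-- The remainder vector `η = ψ − Q(Pψ)` lies in `Ran P̄`: `Pη = 0`. [cite: GustafsonSigal2003, §11.4 (11.29)] -/
theorem proj_apply_sub_fsQ (hP : IsStarProjection P) (hRl : (1 - P) * R = R) (ψ : E) :
    P (ψ - fsQ T P R (P ψ)) = 0 := by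
  have hPP : P * P = P := hP.isIdempotentElem
  rw [map_sub, ← mul_apply_eq_comp P (fsQ T P R), P_mul_fsQ hPP hRl, ← mul_apply_eq_comp, hPP, sub_self]

/-- On `Ran P` the Feshbach–Schur form IS the form of `T` on the dressed vector `Qφ`: `⟪T(Qφ), Qφ⟫ = ⟪F_P(T)φ, φ⟫` for `Pφ = φ`
(the form face of the eigenvector correspondence `ψ = Qφ` (12.11)). [cite: GustafsonSigal2003, §12.2 (12.11); §11.4 (11.30)] -/
theorem inner_apply_fsQ (hP : IsStarProjection P) (hRl : (1 - P) * R = R) (hinv₁ : (1 - P) * T * R = 1 - P)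
    {φ : E} (hφ : P φ = φ) :
    ⟪T (fsQ T P R φ), fsQ T P R φ⟫_𝕜 = ⟪fsMap T P R φ, φ⟫_𝕜 := by
  have hPP : P * P = P := hP.isIdempotentElem
  have hTQ : T (fsQ T P R φ) = fsMap T P R φ := by rw [← mul_apply_eq_comp, mul_fsQ hinv₁]
  have hPF : P (fsMap T P R φ) = fsMap T P R φ := by rw [← mul_apply_eq_comp, P_mul_fsMap hPP]
  have hPQφ : P (fsQ T P R φ) = φ := by rw [← mul_apply_eq_comp, P_mul_fsQ hPP hRl, hφ]
  calc ⟪T (fsQ T P R φ), fsQ T P R φ⟫_𝕜 = ⟪P (fsMap T P R φ), fsQ T P R φ⟫_𝕜 := by rw [hTQ, hPF]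
    _ = ⟪fsMap T P R φ, P (fsQ T P R φ)⟫_𝕜 := inner_proj_left hP _ _
    _ = ⟪fsMap T P R φ, φ⟫_𝕜 := by rw [hPQφ]

/-- The Feshbach–Schur form only sees the `P`-component: `⟪F_P(T)x, x⟫ = ⟪F_P(T)(Px), Px⟫`. [cite: GustafsonSigal2003, §11.1 (11.7)] -/
theorem inner_fsMap_eq_proj (hP : IsStarProjection P) (x : E) :
    ⟪fsMap T P R x, x⟫_𝕜 = ⟪fsMap T P R (P x), P x⟫_𝕜 := by
  have hPP : P * P = P := hP.isIdempotentElem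
  have hFP : fsMap T P R (P x) = fsMap T P R x := by rw [← mul_apply_eq_comp, fsMap_mul_P hPP]
  have hPF : P (fsMap T P R x) = fsMap T P R x := by rw [← mul_apply_eq_comp, P_mul_fsMap hPP]
  calc ⟪fsMap T P R x, x⟫_𝕜 = ⟪P (fsMap T P R x), x⟫_𝕜 := by rw [hPF]
    _ = ⟪fsMap T P R x, P x⟫_𝕜 := inner_proj_left hP _ _
    _ = ⟪fsMap T P R (P x), P x⟫_𝕜 := by rw [hFP]

/-! ## §2 Transmission of positivity (and of negativity) through the Feshbach–Schur map -/

/-- Lower bound: if the stiff block is nonnegative (`re⟪Tx, x⟫ ≥ 0` on `Ran P̄ = ker P`) then `re⟪F_P(T)(Pψ), Pψ⟫ ≤ re⟪Tψ, ψ⟫` for every `ψ`.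
[cite: GustafsonSigal2003, §12.2 (12.9), (12.17)] [cite: HornJohnson2013, Thm. 7.7.7] -/
theorem re_inner_fsMap_le (hP : IsStarProjection P) (hT : IsSelfAdjoint T)
    (hRl : (1 - P) * R = R) (hinv₁ : (1 - P) * T * R = 1 - P)
    (hpos : ∀ x, P x = 0 → 0 ≤ re ⟪T x, x⟫_𝕜) (ψ : E) :
    re ⟪fsMap T P R (P ψ), P ψ⟫_𝕜 ≤ re ⟪T ψ, ψ⟫_𝕜 := by
  rw [re_inner_eq_re_inner_fsMap_add hP hT hRl hinv₁ ψ]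
  exact le_add_of_nonneg_right (hpos _ (proj_apply_sub_fsQ hP hRl ψ))

/-- Upper bound: if the stiff block is nonpositive (`re⟪Tx, x⟫ ≤ 0` on `ker P`) then `re⟪Tψ, ψ⟫ ≤ re⟪F_P(T)(Pψ), Pψ⟫` for every `ψ`.
[cite: GustafsonSigal2003, §12.2 (12.9), (12.17)] [cite: HornJohnson2013, Thm. 7.7.7] -/
theorem re_inner_le_re_inner_fsMap (hP : IsStarProjection P) (hT : IsSelfAdjoint T)
    (hRl : (1 - P) * R = R) (hinv₁ : (1 - P) * T * R = 1 - P)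
    (hneg : ∀ x, P x = 0 → re ⟪T x, x⟫_𝕜 ≤ 0) (ψ : E) :
    re ⟪T ψ, ψ⟫_𝕜 ≤ re ⟪fsMap T P R (P ψ), P ψ⟫_𝕜 := by
  rw [re_inner_eq_re_inner_fsMap_add hP hT hRl hinv₁ ψ]
  exact add_le_of_nonpos_right (hneg _ (proj_apply_sub_fsQ hP hRl ψ))

/-- ★ **Transmission of positivity with constraints** (operator form of Horn–Johnson 7.7.7 (a)⇔(b), with `k` linear constraints in the
slow sector).  Stiff block nonnegative on `ker P`, constraint set `S ⊆ Ran P`.  Then «`re⟪Tψ, ψ⟫ ≥ 0` for every `ψ ⊥ S`» holds iff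
«`re⟪F_P(T)φ, φ⟫ ≥ 0` for every `φ ∈ Ran P` with `φ ⊥ S`».  (⇐: `Pψ ⊥ S` and §1; ⇒: test on `ψ = Qφ`, which is `⊥ S` because `PQ = P`, `PR = 0`.)
[cite: GustafsonSigal2003, §12.2 (12.9)–(12.11), (12.17)] [cite: HornJohnson2013, Thm. 7.7.7] -/
theorem forall_orth_nonneg_iff_fsMap (hP : IsStarProjection P) (hT : IsSelfAdjoint T)
    (hRl : (1 - P) * R = R) (hinv₁ : (1 - P) * T * R = 1 - P)
    (hpos : ∀ x, P x = 0 → 0 ≤ re ⟪T x, x⟫_𝕜) {S : Set E} (hS : ∀ s ∈ S, P s = s) :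
    (∀ ψ : E, (∀ s ∈ S, ⟪s, ψ⟫_𝕜 = 0) → 0 ≤ re ⟪T ψ, ψ⟫_𝕜) ↔
      (∀ φ : E, P φ = φ → (∀ s ∈ S, ⟪s, φ⟫_𝕜 = 0) → 0 ≤ re ⟪fsMap T P R φ, φ⟫_𝕜) := by
  constructor
  · intro h φ hφ horth
    rw [← inner_apply_fsQ hP hRl hinv₁ hφ]
    refine h _ fun s hs => ?_
    rw [inner_fsQ_right_of_mem_range hP hRl (hS s hs), hφ, horth s hs]
  · intro h ψ horth
    have hφ : P (P ψ) = P ψ := by rw [← mul_apply_eq_comp, (hP.isIdempotentElem : P * P = P)]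
    have horth' : ∀ s ∈ S, ⟪s, P ψ⟫_𝕜 = 0 := fun s hs => by
      rw [inner_proj_right_of_mem_range hP (hS s hs), horth s hs]
    exact (h (P ψ) hφ horth').trans (re_inner_fsMap_le hP hT hRl hinv₁ hpos ψ)

/-- ★ **Transmission of negativity with constraints** (the «no intruders» direction for transfer operators): stiff block nonpositive on
`ker P`, `S ⊆ Ran P`.  Then «`re⟪Tψ, ψ⟫ ≤ 0` for every `ψ ⊥ S`» iff «`re⟪F_P(T)φ, φ⟫ ≤ 0` for every `φ ∈ Ran P`, `φ ⊥ S`».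
[cite: GustafsonSigal2003, §12.2 (12.9)–(12.11), (12.17)] [cite: HornJohnson2013, Thm. 7.7.7] -/
theorem forall_orth_nonpos_iff_fsMap (hP : IsStarProjection P) (hT : IsSelfAdjoint T)
    (hRl : (1 - P) * R = R) (hinv₁ : (1 - P) * T * R = 1 - P)
    (hneg : ∀ x, P x = 0 → re ⟪T x, x⟫_𝕜 ≤ 0) {S : Set E} (hS : ∀ s ∈ S, P s = s) :
    (∀ ψ : E, (∀ s ∈ S, ⟪s, ψ⟫_𝕜 = 0) → re ⟪T ψ, ψ⟫_𝕜 ≤ 0) ↔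
      (∀ φ : E, P φ = φ → (∀ s ∈ S, ⟪s, φ⟫_𝕜 = 0) → re ⟪fsMap T P R φ, φ⟫_𝕜 ≤ 0) := by
  constructor
  · intro h φ hφ horth
    rw [← inner_apply_fsQ hP hRl hinv₁ hφ]
    refine h _ fun s hs => ?_
    rw [inner_fsQ_right_of_mem_range hP hRl (hS s hs), hφ, horth s hs]
  · intro h ψ horth
    have hφ : P (P ψ) = P ψ := by rw [← mul_apply_eq_comp, (hP.isIdempotentElem : P * P = P)]
    have horth' : ∀ s ∈ S, ⟪s, P ψ⟫_𝕜 = 0 := fun s hs => by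
      rw [inner_proj_right_of_mem_range hP (hS s hs), horth s hs]
    exact (re_inner_le_re_inner_fsMap hP hT hRl hinv₁ hneg ψ).trans (h (P ψ) hφ horth')

/-! ## §3b The corner inverse on a Hilbert space: self-adjointness, sign, bounds, existence from a gap -/

/-- `R_{P̄}` is SELF-ADJOINT whenever `P`, `T` are: a RIGHT corner inverse (`R = RP̄`, `RTP̄ = P̄`) has an adjoint which is a LEFT corner
inverse, and corner inverses are unique.
[cite: GustafsonSigal2003, §11.1 (11.6), (11.9)] -/
theorem isSelfAdjoint_cornerInverse (hP : IsStarProjection P) (hT : IsSelfAdjoint T)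
    (hRr : R * (1 - P) = R) (hinv₂ : R * T * (1 - P) = 1 - P) : IsSelfAdjoint R := by
  have hPs : star P = P := hP.isSelfAdjoint.star_eq
  have hTs : star T = T := hT.star_eq
  have h1s : star (1 - P) = 1 - P := by rw [star_sub, star_one, hPs]
  -- `star R` is a right corner inverse
  have hR'l : (1 - P) * star R = star R := by
    have := congrArg star hRr
    rwa [star_mul, h1s] at this
  have hinv₁' : (1 - P) * T * star R = 1 - P := by
    have := congrArg star hinv₂
    rwa [star_mul, star_mul, h1s, hTs, ← mul_assoc] at this
  have h := corner_inverse_unique (T := T) hRr hR'l hinv₂ hinv₁'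
  -- `IsSelfAdjoint R ↔ star R = R`
  exact h.symm

/-- With self-adjoint data the Feshbach–Schur map `F_P(T)` is self-adjoint ((11.9), `R_{P̄}` being self-adjoint by uniqueness).
[cite: GustafsonSigal2003, §11.1 (11.9)] -/
theorem isSelfAdjoint_fsMap (hP : IsStarProjection P) (hT : IsSelfAdjoint T)
    (hRr : R * (1 - P) = R) (hinv₂ : R * T * (1 - P) = 1 - P) : IsSelfAdjoint (fsMap T P R) :=
  star_fsMap hT.star_eq hP.isSelfAdjoint.star_eq
    (isSelfAdjoint_cornerInverse hP hT hRr hinv₂).star_eq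

/-- `⟪Rx, x⟫ = ⟪T(Rx), Rx⟫` (from `RTR = R` and self-adjointness of `R`). [cite: GustafsonSigal2003, §11.1 (11.6)] -/
theorem inner_cornerInverse_eq (hP : IsStarProjection P) (hT : IsSelfAdjoint T)
    (hRl : (1 - P) * R = R) (hRr : R * (1 - P) = R) (hinv₂ : R * T * (1 - P) = 1 - P) (x : E) :
    ⟪R x, x⟫_𝕜 = ⟪T (R x), R x⟫_𝕜 := by
  have hR : IsSelfAdjoint R := isSelfAdjoint_cornerInverse hP hT hRr hinv₂
  have hRTR : R (T (R x)) = R x := by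
    have := congrArg (fun S : E →L[𝕜] E => S x) (cornerInverse_mul_mul_self (T := T) hRl hinv₂)
    simpa using this
  calc ⟪R x, x⟫_𝕜 = ⟪R (T (R x)), x⟫_𝕜 := by rw [hRTR]
    _ = ⟪T (R x), R x⟫_𝕜 := hR.isSymmetric _ _

/-- A nonnegative stiff block has a NONNEGATIVE corner inverse: `0 ≤ re⟪Rx, x⟫`. [cite: GustafsonSigal2003, §12.2 (12.17), (12.8)] -/
theorem re_inner_cornerInverse_nonneg (hP : IsStarProjection P) (hT : IsSelfAdjoint T)
    (hRl : (1 - P) * R = R) (hRr : R * (1 - P) = R) (hinv₂ : R * T * (1 - P) = 1 - P)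
    (hpos : ∀ x, P x = 0 → 0 ≤ re ⟪T x, x⟫_𝕜) (x : E) : 0 ≤ re ⟪R x, x⟫_𝕜 := by
  rw [inner_cornerInverse_eq hP hT hRl hRr hinv₂]
  exact hpos _ (proj_apply_cornerInverse hP hRl x)

/-- A nonpositive stiff block has a NONPOSITIVE corner inverse: `re⟪Rx, x⟫ ≤ 0`. [cite: GustafsonSigal2003, §12.2 (12.17), (12.8)] -/
theorem re_inner_cornerInverse_nonpos (hP : IsStarProjection P) (hT : IsSelfAdjoint T)
    (hRl : (1 - P) * R = R) (hRr : R * (1 - P) = R) (hinv₂ : R * T * (1 - P) = 1 - P)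
    (hneg : ∀ x, P x = 0 → re ⟪T x, x⟫_𝕜 ≤ 0) (x : E) : re ⟪R x, x⟫_𝕜 ≤ 0 := by
  rw [inner_cornerInverse_eq hP hT hRl hRr hinv₂]
  exact hneg _ (proj_apply_cornerInverse hP hRl x)

/-- Under COERCIVITY of the stiff block, `δ‖x‖² ≤ re⟪Tx, x⟫` on `ker P` (`δ > 0`), the corner inverse is bounded: `‖Rx‖ ≤ δ⁻¹‖x‖`.
[cite: GustafsonSigal2003, §12.2 (12.17)] -/
theorem norm_cornerInverse_apply_le (hP : IsStarProjection P) (hT : IsSelfAdjoint T)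
    (hRl : (1 - P) * R = R) (hRr : R * (1 - P) = R) (hinv₂ : R * T * (1 - P) = 1 - P)
    {δ : ℝ} (hδ : 0 < δ) (hcoer : ∀ x, P x = 0 → δ * ‖x‖ ^ 2 ≤ re ⟪T x, x⟫_𝕜) (x : E) :
    ‖R x‖ ≤ δ⁻¹ * ‖x‖ := by
  have h1 : δ * ‖R x‖ ^ 2 ≤ re ⟪R x, x⟫_𝕜 := by
    rw [inner_cornerInverse_eq hP hT hRl hRr hinv₂]
    exact hcoer _ (proj_apply_cornerInverse hP hRl x)
  have h2 : re ⟪R x, x⟫_𝕜 ≤ ‖R x‖ * ‖x‖ := (re_le_norm _).trans (norm_inner_le_norm _ _)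
  have h3 : δ * ‖R x‖ ^ 2 ≤ ‖R x‖ * ‖x‖ := h1.trans h2
  by_cases hRx : R x = 0
  · rw [hRx, norm_zero]; positivity
  · have hpos : 0 < ‖R x‖ := norm_pos_iff.mpr hRx
    rw [sq, ← mul_assoc, mul_comm ‖R x‖ ‖x‖] at h3
    have h4 : δ * ‖R x‖ ≤ ‖x‖ := le_of_mul_le_mul_right h3 hpos
    calc ‖R x‖ = δ⁻¹ * (δ * ‖R x‖) := by field_simp
      _ ≤ δ⁻¹ * ‖x‖ := by gcongr

/-- … hence `‖R‖ ≤ δ⁻¹`. [cite: GustafsonSigal2003, §12.2 (12.17)] -/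
theorem opNorm_cornerInverse_le (hP : IsStarProjection P) (hT : IsSelfAdjoint T)
    (hRl : (1 - P) * R = R) (hRr : R * (1 - P) = R) (hinv₂ : R * T * (1 - P) = 1 - P)
    {δ : ℝ} (hδ : 0 < δ) (hcoer : ∀ x, P x = 0 → δ * ‖x‖ ^ 2 ≤ re ⟪T x, x⟫_𝕜) : ‖R‖ ≤ δ⁻¹ :=
  ContinuousLinearMap.opNorm_le_bound _ (by positivity)
    (norm_cornerInverse_apply_le hP hT hRl hRr hinv₂ hδ hcoer)

/-- … and `re⟪Rx, x⟫ ≤ δ⁻¹‖x‖²`. [cite: GustafsonSigal2003, §12.2 (12.17)] -/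
theorem re_inner_cornerInverse_le (hP : IsStarProjection P) (hT : IsSelfAdjoint T)
    (hRl : (1 - P) * R = R) (hRr : R * (1 - P) = R) (hinv₂ : R * T * (1 - P) = 1 - P)
    {δ : ℝ} (hδ : 0 < δ) (hcoer : ∀ x, P x = 0 → δ * ‖x‖ ^ 2 ≤ re ⟪T x, x⟫_𝕜) (x : E) :
    re ⟪R x, x⟫_𝕜 ≤ δ⁻¹ * ‖x‖ ^ 2 := by
  have h := norm_cornerInverse_apply_le hP hT hRl hRr hinv₂ hδ hcoer x
  calc re ⟪R x, x⟫_𝕜 ≤ ‖R x‖ * ‖x‖ := (re_le_norm _).trans (norm_inner_le_norm _ _)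
    _ ≤ δ⁻¹ * ‖x‖ * ‖x‖ := by gcongr
    _ = δ⁻¹ * ‖x‖ ^ 2 := by ring

/-- ★ **Existence of `R_{P̄}` from a gap** (the book's (12.17) ⟹ condition (a)): if `P` is an orthogonal projection and the stiff block
of the bounded operator `T` is COERCIVE, `δ‖x‖² ≤ re⟪Tx, x⟫` for all `x ∈ ker P` (`δ > 0`; no self-adjointness needed — Lax–Milgram), then
`P̄TP̄ ↾ Ran P̄` is invertible:
there is `R` with `P̄R = R = RP̄`, `P̄TR = P̄`, `RTP̄ = P̄` — exactly the data of `FeshbachSchurMap` (`isUnit_iff_exists_corner_inverse`,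
`smul_eq_zero_iff_fsMap`) and of §§1–2 here.  Proof: the block-diagonal operator `P + P̄TP̄` satisfies
`re⟪(P + P̄TP̄)x, x⟫ = ‖Px‖² + re⟪TP̄x, P̄x⟫ ≥ min(1, δ)‖x‖²`, hence is a unit, and `exists_corner_inverse_of_isUnit_add` applies.
[cite: GustafsonSigal2003, §12.2 (12.17); §11.1 (11.6)] -/
theorem exists_fsData_of_coercive (hP : IsStarProjection P) {δ : ℝ} (hδ : 0 < δ)
    (hcoer : ∀ x, P x = 0 → δ * ‖x‖ ^ 2 ≤ re ⟪T x, x⟫_𝕜) :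
    ∃ R : E →L[𝕜] E, (1 - P) * R = R ∧ R * (1 - P) = R ∧ (1 - P) * T * R = 1 - P ∧ R * T * (1 - P) = 1 - P := by
  have hPP : P * P = P := hP.isIdempotentElem
  have hPbar : (1 - P) * (1 - P) = 1 - P := by
    rw [mul_sub, sub_mul, one_mul, mul_one, sub_mul, one_mul, hPP, sub_self, sub_zero]
  set T' : E →L[𝕜] E := (1 - P) * T * (1 - P) with hT'
  have hTl : (1 - P) * T' = T' := by rw [hT', ← mul_assoc, ← mul_assoc, hPbar]
  have hTr : T' * (1 - P) = T' := by rw [hT', mul_assoc, hPbar]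
  -- the block-diagonal operator is bounded below
  have hm : (0 : ℝ) < min 1 δ := lt_min one_pos hδ
  have hbound : ∀ x : E, ‖x‖ ^ 2 * (⟨min 1 δ, hm.le⟩ : NNReal) ≤ ‖⟪(P + T') x, x⟫_𝕜‖ := by
    intro x
    have hPx : ⟪P x, x⟫_𝕜 = ⟪P x, P x⟫_𝕜 := inner_proj_self hP x
    have hT'x : ⟪T' x, x⟫_𝕜 = ⟪T ((1 - P) x), (1 - P) x⟫_𝕜 := by
      have e : T' x = (1 - P) (T ((1 - P) x)) := by rw [hT']; simp
      rw [e, inner_proj_left hP.one_sub]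
    have hre : re ⟪(P + T') x, x⟫_𝕜 = ‖P x‖ ^ 2 + re ⟪T ((1 - P) x), (1 - P) x⟫_𝕜 := by
      rw [add_apply, inner_add_left, map_add, hPx, hT'x, inner_self_eq_norm_sq]
    have hker : P ((1 - P) x) = 0 := proj_apply_one_sub hP x
    have hc := hcoer _ hker
    have hpy := norm_sq_eq_proj_add hP x
    calc ‖x‖ ^ 2 * ((⟨min 1 δ, hm.le⟩ : NNReal) : ℝ) = min 1 δ * ‖P x‖ ^ 2 + min 1 δ * ‖(1 - P) x‖ ^ 2 := by
          change ‖x‖ ^ 2 * min 1 δ = _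
          rw [hpy]; ring
      _ ≤ 1 * ‖P x‖ ^ 2 + δ * ‖(1 - P) x‖ ^ 2 := by
          gcongr
          · exact min_le_left _ _
          · exact min_le_right _ _
      _ ≤ re ⟪(P + T') x, x⟫_𝕜 := by rw [hre, one_mul]; gcongr
      _ ≤ ‖⟪(P + T') x, x⟫_𝕜‖ := re_le_norm _
  have hu : IsUnit (P + T') := ContinuousLinearMap.isUnit_of_forall_le_norm_inner_map (P + T') hm hbound
  obtain ⟨R, hRl, hRr, hTR, hRT⟩ := exists_corner_inverse_of_isUnit_add hPP hTl hTr hu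
  refine ⟨R, hRl, hRr, ?_, ?_⟩
  · rwa [hT', mul_assoc ((1 - P) * T) (1 - P) R, hRl] at hTR
  · rwa [hT', ← mul_assoc, ← mul_assoc, hRr] at hRT

/-- Mirror image: a stiff block coercive from ABOVE, `re⟪Tx, x⟫ ≤ −δ‖x‖²` on `ker P`, is invertible in the corner as well (apply the
previous result to `−T` and negate `R`). [cite: GustafsonSigal2003, §12.2 (12.17); §11.1 (11.6)] -/
theorem exists_fsData_of_coercive_neg (hP : IsStarProjection P) {δ : ℝ} (hδ : 0 < δ)
    (hcoer : ∀ x, P x = 0 → re ⟪T x, x⟫_𝕜 ≤ -(δ * ‖x‖ ^ 2)) :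
    ∃ R : E →L[𝕜] E, (1 - P) * R = R ∧ R * (1 - P) = R ∧ (1 - P) * T * R = 1 - P ∧ R * T * (1 - P) = 1 - P := by
  have hcoer' : ∀ x, P x = 0 → δ * ‖x‖ ^ 2 ≤ re ⟪(-T) x, x⟫_𝕜 := by
    intro x hx
    have := hcoer x hx
    rw [neg_apply, inner_neg_left, map_neg]
    linarith
  obtain ⟨R, hRl, hRr, h₁, h₂⟩ := exists_fsData_of_coercive hP hδ hcoer'
  refine ⟨-R, by rw [mul_neg, hRl], by rw [neg_mul, hRr], ?_, ?_⟩
  · rw [mul_neg, ← neg_mul, ← mul_neg]; simpa only [mul_neg, neg_mul, neg_neg] using h₁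
  · simpa only [mul_neg, neg_mul, neg_neg] using h₂

/-! ## §2b The Loewner form -/

/-- ★ **Transmission of positivity, Loewner form**: with an orthogonal projection `P`, self-adjoint `T`, Feshbach data `R` and a
nonnegative stiff block, `T ≥ 0 ⟺ F_P(T) ≥ 0` as operators on `E` (`F_P(T) = PF_P(T)P` vanishes on `Ran P̄`, so positivity of `F_P(T)` on
`E` is positivity on `Ran P`).  [cite: GustafsonSigal2003, §12.2 (12.9)–(12.10), (12.17)] [cite: HornJohnson2013, Thm. 7.7.7] -/
theorem isPositive_iff_isPositive_fsMap (hP : IsStarProjection P) (hT : IsSelfAdjoint T)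
    (hRl : (1 - P) * R = R) (hRr : R * (1 - P) = R)
    (hinv₁ : (1 - P) * T * R = 1 - P) (hinv₂ : R * T * (1 - P) = 1 - P)
    (hpos : ∀ x, P x = 0 → 0 ≤ re ⟪T x, x⟫_𝕜) :
    T.IsPositive ↔ (fsMap T P R).IsPositive := by
  have hF : IsSelfAdjoint (fsMap T P R) := isSelfAdjoint_fsMap hP hT hRr hinv₂
  have key := forall_orth_nonneg_iff_fsMap hP hT hRl hinv₁ hpos (S := (∅ : Set E)) (by simp)
  simp only [Set.mem_empty_iff_false, false_implies, implies_true, forall_const] at key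
  rw [ContinuousLinearMap.isPositive_def', ContinuousLinearMap.isPositive_def']
  simp only [hT, hF, true_and, ContinuousLinearMap.reApplyInnerSelf_apply]
  constructor
  · intro h x
    rw [inner_fsMap_eq_proj hP x]
    have hφ : P (P x) = P x := by rw [← mul_apply_eq_comp, (hP.isIdempotentElem : P * P = P)]
    exact key.mp h (P x) hφ
  · intro h
    exact key.mpr fun φ _ => h φ

/-! ## §4 ★ The variational Feshbach principle (shifted forms, ready for min–max doors) -/

section Shifted

variable {H K : E →L[𝕜] E}

omit [CompleteSpace E] in
/-- The form of `H − c·1`: `re⟪(H − c1)ψ, ψ⟫ = re⟪Hψ, ψ⟫ − c‖ψ‖²` for real `c`. [folklore] -/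
private theorem re_inner_sub_smul_one_apply (H : E →L[𝕜] E) (c : ℝ) (ψ : E) :
    re ⟪(H - (c : 𝕜) • (1 : E →L[𝕜] E)) ψ, ψ⟫_𝕜 = re ⟪H ψ, ψ⟫_𝕜 - c * ‖ψ‖ ^ 2 := by
  rw [sub_apply, smul_apply, one_apply_eq_self, inner_sub_left, map_sub, inner_smul_left, conj_ofReal,
    re_ofReal_mul, inner_self_eq_norm_sq]

/-- On `Ran P` the Feshbach–Schur form of the shifted operator is the shifted Feshbach–Schur form:
`re⟪F_P(H − c1)φ, φ⟫ = re⟪(PHP − PHRHP)φ, φ⟫ − c‖φ‖²` for `Pφ = φ` (because `PR = 0 = RP`). [cite: GustafsonSigal2003, §12.2 (12.9)] -/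
theorem re_inner_fsMap_sub_smul_one (hP : IsStarProjection P) (hRl : (1 - P) * R = R) (hRr : R * (1 - P) = R)
    (c : ℝ) {φ : E} (hφ : P φ = φ) :
    re ⟪fsMap (H - (c : 𝕜) • (1 : E →L[𝕜] E)) P R φ, φ⟫_𝕜 = re ⟪fsMap H P R φ, φ⟫_𝕜 - c * ‖φ‖ ^ 2 := by
  have hPP : P * P = P := hP.isIdempotentElem
  have hPR : P * R = 0 := P_mul_R hPP hRl
  have hRP : R * P = 0 := R_mul_P hPP hRr
  set S : E →L[𝕜] E := (c : 𝕜) • (1 : E →L[𝕜] E) with hS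
  have hS1 : ∀ X : E →L[𝕜] E, X * S = (c : 𝕜) • X := fun X => by rw [hS, mul_smul_comm, mul_one]
  have e1 : P * (H - S) * P = P * H * P - (c : 𝕜) • P := by
    rw [mul_sub, sub_mul, hS1, smul_mul_assoc, hPP]
  have e2 : P * (H - S) * R = P * H * R := by
    rw [mul_sub, sub_mul, hS1, smul_mul_assoc, hPR, smul_zero, sub_zero]
  have e3 : P * H * R * (H - S) * P = P * H * R * H * P := by
    rw [mul_sub, sub_mul, hS1, smul_mul_assoc, mul_assoc (P * H) R P, hRP, mul_zero, smul_zero, sub_zero]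
  have e : fsMap (H - S) P R = fsMap H P R - (c : 𝕜) • P := by
    rw [fsMap_def, fsMap_def, e2, e3, e1]; abel
  rw [e, sub_apply, smul_apply, hφ, inner_sub_left, map_sub, inner_smul_left, conj_ofReal, re_ofReal_mul,
    inner_self_eq_norm_sq]

/-- `H − c·1` is self-adjoint for real `c`. [folklore] -/
private theorem isSelfAdjoint_sub_smul_one (hH : IsSelfAdjoint H) (c : ℝ) :
    IsSelfAdjoint (H - (c : 𝕜) • (1 : E →L[𝕜] E)) := by
  have hc : IsSelfAdjoint (c : 𝕜) := by
    rw [isSelfAdjoint_iff, RCLike.star_def, conj_ofReal]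
  exact hH.sub (hc.smul (.one _))

/-- ★ **Variational Feshbach–Schur principle, Schrödinger (inf) form.**  `P` an orthogonal projection, `H` bounded self-adjoint whose
STIFF SECTOR LIES ABOVE `λ`: `(λ + δ)‖x‖² ≤ re⟪Hx, x⟫` for all `x ∈ ker P = Ran P̄`, some `δ > 0`.  Then there is `R = (H^⊥ − λ)⁻¹` on `Ran P̄`
(the four corner relations for `H − λ·1`; self-adjoint; `0 ≤ re⟪Rx, x⟫ ≤ δ⁻¹‖x‖²`) such that for EVERY set `S ⊆ Ran P` of constraint vectors
  `(∀ ψ ⊥ S, λ‖ψ‖² ≤ re⟪Hψ, ψ⟫) ⟺ (∀ φ ∈ Ran P, φ ⊥ S → λ‖φ‖² ≤ re⟪(PHP − PHRHP)φ, φ⟫)`: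
«`H ≥ λ` on `S^⊥`» is EQUIVALENT to «the effective operator `PHP − U(λ)`, `U(λ) = PHR_λHP ≥ 0`, is `≥ λ` on `Ran P ∩ S^⊥`» — the bottom of
the spectrum (and, taking for `S` lower eigenvectors lying in the slow sector, the min–max levels below the stiff threshold) is decided
in the slow sector ((12.10)–(12.11) at the bottom of the spectrum; the book's use in the proof of Thm. 12.1 «the ground state energy of
`H_mol` is the ground state energy of `H_nucl + v + w(E₀)`»).
[cite: GustafsonSigal2003, §12.2 (12.8)–(12.11), (12.17), Thm. 12.1 (proof)] [cite: HornJohnson2013, Thm. 7.7.7] -/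
theorem feshbach_inf_principle (hP : IsStarProjection P) (hH : IsSelfAdjoint H) {lam δ : ℝ} (hδ : 0 < δ)
    (hgap : ∀ x, P x = 0 → (lam + δ) * ‖x‖ ^ 2 ≤ re ⟪H x, x⟫_𝕜) :
    ∃ R : E →L[𝕜] E, IsSelfAdjoint R ∧ (1 - P) * R = R ∧ R * (1 - P) = R ∧
      (1 - P) * (H - (lam : 𝕜) • (1 : E →L[𝕜] E)) * R = 1 - P ∧
      R * (H - (lam : 𝕜) • (1 : E →L[𝕜] E)) * (1 - P) = 1 - P ∧
      (∀ x, 0 ≤ re ⟪R x, x⟫_𝕜) ∧ (∀ x, re ⟪R x, x⟫_𝕜 ≤ δ⁻¹ * ‖x‖ ^ 2) ∧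
      ∀ S : Set E, (∀ s ∈ S, P s = s) →
        ((∀ ψ : E, (∀ s ∈ S, ⟪s, ψ⟫_𝕜 = 0) → lam * ‖ψ‖ ^ 2 ≤ re ⟪H ψ, ψ⟫_𝕜) ↔
          (∀ φ : E, P φ = φ → (∀ s ∈ S, ⟪s, φ⟫_𝕜 = 0) →
            lam * ‖φ‖ ^ 2 ≤ re ⟪(P * H * P - P * H * R * H * P) φ, φ⟫_𝕜)) := by
  set T : E →L[𝕜] E := H - (lam : 𝕜) • (1 : E →L[𝕜] E) with hTdef
  have hT : IsSelfAdjoint T := isSelfAdjoint_sub_smul_one hH lam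
  have hTform : ∀ ψ : E, re ⟪T ψ, ψ⟫_𝕜 = re ⟪H ψ, ψ⟫_𝕜 - lam * ‖ψ‖ ^ 2 :=
    re_inner_sub_smul_one_apply H lam
  have hcoer : ∀ x, P x = 0 → δ * ‖x‖ ^ 2 ≤ re ⟪T x, x⟫_𝕜 := by
    intro x hx
    rw [hTform]
    have h := hgap x hx
    rw [add_mul] at h
    linarith
  have hpos : ∀ x, P x = 0 → 0 ≤ re ⟪T x, x⟫_𝕜 := fun x hx =>
    le_trans (by positivity) (hcoer x hx)
  obtain ⟨R, hRl, hRr, h₁, h₂⟩ := exists_fsData_of_coercive hP hδ hcoer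
  refine ⟨R, isSelfAdjoint_cornerInverse hP hT hRr h₂, hRl, hRr, h₁, h₂,
    re_inner_cornerInverse_nonneg hP hT hRl hRr h₂ hpos,
    re_inner_cornerInverse_le hP hT hRl hRr h₂ hδ hcoer, fun S hS => ?_⟩
  have key := forall_orth_nonneg_iff_fsMap hP hT hRl h₁ hpos hS
  have hFform : ∀ φ : E, P φ = φ →
      re ⟪fsMap T P R φ, φ⟫_𝕜 = re ⟪(P * H * P - P * H * R * H * P) φ, φ⟫_𝕜 - lam * ‖φ‖ ^ 2 := fun φ hφ => by
    rw [hTdef, re_inner_fsMap_sub_smul_one hP hRl hRr lam hφ, ← fsMap_def]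
  constructor
  · intro h φ hφ horth
    have h' : ∀ ψ : E, (∀ s ∈ S, ⟪s, ψ⟫_𝕜 = 0) → 0 ≤ re ⟪T ψ, ψ⟫_𝕜 := fun ψ hψ => by
      rw [hTform]; linarith [h ψ hψ]
    have := key.mp h' φ hφ horth
    rw [hFform φ hφ] at this
    linarith
  · intro h ψ hψ
    have h' : ∀ φ : E, P φ = φ → (∀ s ∈ S, ⟪s, φ⟫_𝕜 = 0) → 0 ≤ re ⟪fsMap T P R φ, φ⟫_𝕜 :=
      fun φ hφ horth => by rw [hFform φ hφ]; linarith [h φ hφ horth]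
    have := key.mpr h' ψ hψ
    rw [hTform] at this
    linarith

/-- ★ **Variational Feshbach–Schur principle, transfer-operator (sup) form** («no intruders»).  `P` an orthogonal projection, `K` bounded
self-adjoint whose STIFF SECTOR LIES BELOW `μ`: `re⟪Kx, x⟫ ≤ (μ − δ)‖x‖²` for all `x ∈ ker P = Ran P̄`, some `δ > 0`.  Then there is
`G = (μ − K^⊥)⁻¹` on `Ran P̄` (the four corner relations for `μ·1 − K`; self-adjoint; `0 ≤ re⟪Gx, x⟫ ≤ δ⁻¹‖x‖²`) such that for EVERY set
`S ⊆ Ran P` of constraint vectors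
  `(∀ ψ ⊥ S, re⟪Kψ, ψ⟫ ≤ μ‖ψ‖²) ⟺ (∀ φ ∈ Ran P, φ ⊥ S → re⟪(PKP + PKGKP)φ, φ⟫ ≤ μ‖φ‖²)`:
«no vector orthogonal to `S` has Rayleigh quotient above `μ`» is EQUIVALENT to the same statement for the slow-sector EFFECTIVE TRANSFER
OPERATOR `PKP + PK(μ − K^⊥)⁻¹KP` on `Ran P` — the lossless input of an inf–sup door (`S` = `k` slow constraint vectors).
[cite: GustafsonSigal2003, §12.2 (12.8)–(12.11), (12.17)] [cite: HornJohnson2013, Thm. 7.7.7] -/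
theorem feshbach_sup_principle (hP : IsStarProjection P) (hK : IsSelfAdjoint K) {mu δ : ℝ} (hδ : 0 < δ)
    (hgap : ∀ x, P x = 0 → re ⟪K x, x⟫_𝕜 ≤ (mu - δ) * ‖x‖ ^ 2) :
    ∃ G : E →L[𝕜] E, IsSelfAdjoint G ∧ (1 - P) * G = G ∧ G * (1 - P) = G ∧
      (1 - P) * ((mu : 𝕜) • (1 : E →L[𝕜] E) - K) * G = 1 - P ∧
      G * ((mu : 𝕜) • (1 : E →L[𝕜] E) - K) * (1 - P) = 1 - P ∧
      (∀ x, 0 ≤ re ⟪G x, x⟫_𝕜) ∧ (∀ x, re ⟪G x, x⟫_𝕜 ≤ δ⁻¹ * ‖x‖ ^ 2) ∧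
      ∀ S : Set E, (∀ s ∈ S, P s = s) →
        ((∀ ψ : E, (∀ s ∈ S, ⟪s, ψ⟫_𝕜 = 0) → re ⟪K ψ, ψ⟫_𝕜 ≤ mu * ‖ψ‖ ^ 2) ↔
          (∀ φ : E, P φ = φ → (∀ s ∈ S, ⟪s, φ⟫_𝕜 = 0) →
            re ⟪(P * K * P + P * K * G * K * P) φ, φ⟫_𝕜 ≤ mu * ‖φ‖ ^ 2)) := by
  -- apply the inf form to `H = −K`, `λ = −μ`
  have hH : IsSelfAdjoint (-K) := hK.neg
  have hgap' : ∀ x, P x = 0 → (-mu + δ) * ‖x‖ ^ 2 ≤ re ⟪(-K) x, x⟫_𝕜 := by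
    intro x hx
    rw [neg_apply, inner_neg_left, map_neg]
    have h := hgap x hx
    linarith
  obtain ⟨G, hGs, hGl, hGr, h₁, h₂, hG0, hGδ, hiff⟩ := feshbach_inf_principle hP hH hδ hgap'
  have e : (-K) - (((-mu : ℝ) : 𝕜)) • (1 : E →L[𝕜] E) = (mu : 𝕜) • (1 : E →L[𝕜] E) - K := by
    rw [ofReal_neg, neg_smul, sub_neg_eq_add, add_comm, sub_eq_add_neg]
  rw [e] at h₁ h₂
  refine ⟨G, hGs, hGl, hGr, h₁, h₂, hG0, hGδ, fun S hS => ?_⟩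
  have key := hiff S hS
  have e2 : P * (-K) * P - P * (-K) * G * (-K) * P = -(P * K * P + P * K * G * K * P) := by
    simp only [mul_neg, neg_mul, neg_neg, neg_add, sub_eq_add_neg]
  rw [e2] at key
  constructor
  · intro h φ hφ horth
    have h' : ∀ ψ : E, (∀ s ∈ S, ⟪s, ψ⟫_𝕜 = 0) → -mu * ‖ψ‖ ^ 2 ≤ re ⟪(-K) ψ, ψ⟫_𝕜 := fun ψ hψ => by
      rw [neg_apply, inner_neg_left, map_neg]; linarith [h ψ hψ]
    have := key.mp h' φ hφ horth
    rw [neg_apply, inner_neg_left, map_neg] at this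
    linarith
  · intro h ψ hψ
    have h' : ∀ φ : E, P φ = φ → (∀ s ∈ S, ⟪s, φ⟫_𝕜 = 0) →
        -mu * ‖φ‖ ^ 2 ≤ re ⟪(-(P * K * P + P * K * G * K * P)) φ, φ⟫_𝕜 := fun φ hφ horth => by
      rw [neg_apply, inner_neg_left, map_neg]; linarith [h φ hφ horth]
    have := key.mpr h' ψ hψ
    rw [neg_apply, inner_neg_left, map_neg] at this
    linarith

end Shifted

end Hilbert

end Literature.Analysis.OperatorTheory.FeshbachSchur
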